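import Literature.NumberTheory.Sieve.SmoothLargeValues
import Literature.NumberTheory.Sieve.SmoothSaddlePointApprox
import HarnessLib

/-!
# Restriction for smooth numbers, I: the large-values count with Harper's parameters

Topic `Literature/NumberTheory/Sieve`; a PROVED file toward
`Literature.NumberTheory.DiophantineGeometry.XYZUpperHalf` ([Harper2016, Cor. 1]). We specialise
the parametric large-values inequality `largeValues_ineq` as at the end of §4 of op. cit.
(p. 18): with `δ' = min(δ, 1/log x)`, `u = log x/δ'`, `K = ⌊u²⁰⌋`, `Q⋆ = K²` (printed:
`K = ⌊(δ⁻¹ log x)¹⁰⌋`, `Q = K log¹² x`), all the "negligible" terms are `≤ δ'²/2` once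
`1 − α(x,y) ≤ 10⁻⁴`, `𝓟 ≥ x^{24/25}` and `δ ≥ (log x) x^{−1/20000}`, and we obtain

`largeValues_count_le`: `R ≤ C (log x)¹⁹ δ^{−49/20}`

for `1/x`-separated points `θ_r` with `|∑_{n ≤ x, n ∈ S(y)} a_n e(nθ_r)| ≥ δ𝓟` (`|a_n| ≤ 1`), i.e. Harper's
(4.1) `R ≪ δ^{−2−O(1−α)−ε} log^{O(1)} x` with our exponent `12/5` from
`BourgainSpacing.sum_sum_majorArcWeight_le` in place of `2`.

## References

* A. J. Harper, *Minor arcs, mean values, and restriction theory for exponential sums over smooth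
  numbers*, Compositio Math. 152 (2016) 1121–1158, §4, (4.1) and p. 18 [Harper2016].
-/

noncomputable section

open Finset Real
open scoped FourierTransform

namespace Literature.NumberTheory.Sieve

/-! ### Small tools -/

/-- `t/2 ≤ ⌊t⌋` for `t ≥ 2` (private copy of `TypeIFromWeyl.half_le_floor`, not imported here). [folklore] -/
private theorem half_le_floor {t : ℝ} (ht : 2 ≤ t) : t / 2 ≤ ⌊t⌋₊ := by
  have := Nat.lt_floor_add_one t
  linarith

/-- Powers of `log x` against powers of `x`: if `4n²/d² ≤ log x` then `(log x)^n ≤ x^d`.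
[folklore] -/
theorem logpow_le_rpow {x d : ℝ} {n : ℕ} (hd : 0 < d) (hx : 1 < x)
    (h : 4 * (n : ℝ) ^ 2 / d ^ 2 ≤ Real.log x) : Real.log x ^ n ≤ x ^ d := by
  have hx0 : 0 < x := by linarith
  set L := Real.log x with hL
  have hL0 : 0 < L := Real.log_pos hx
  rcases le_or_gt L 1 with hL1 | hL1
  · calc L ^ n ≤ 1 := pow_le_one₀ hL0.le hL1
      _ ≤ x ^ d := Real.one_le_rpow hx.le hd.le
  · -- `n log L ≤ 2 n √L ≤ d L`
    have hlogL : Real.log L ≤ 2 * Real.sqrt L := by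
      have h1 := Real.log_le_rpow_div hL0.le (by norm_num : (0 : ℝ) < 1 / 2)
      rw [← Real.sqrt_eq_rpow] at h1
      have h2 : Real.sqrt L / (1 / 2) = 2 * Real.sqrt L := by ring
      linarith [h1, h2]
    have hsq : 2 * (n : ℝ) ≤ d * Real.sqrt L := by
      have h1 : (2 * (n : ℝ)) ^ 2 ≤ (d * Real.sqrt L) ^ 2 := by
        rw [mul_pow, mul_pow, Real.sq_sqrt hL0.le]
        rw [div_le_iff₀ (by positivity)] at h
        nlinarith
      have h2 := Real.sqrt_le_sqrt h1
      rwa [Real.sqrt_sq (by positivity), Real.sqrt_sq (by positivity)] at h2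
    have hlogL0 : 0 ≤ Real.log L := Real.log_nonneg hL1.le
    have hkey : (n : ℝ) * Real.log L ≤ d * L := by
      calc (n : ℝ) * Real.log L ≤ (n : ℝ) * (2 * Real.sqrt L) :=
            mul_le_mul_of_nonneg_left hlogL (Nat.cast_nonneg _)
        _ = (2 * (n : ℝ)) * Real.sqrt L := by ring
        _ ≤ (d * Real.sqrt L) * Real.sqrt L := mul_le_mul_of_nonneg_right hsq (Real.sqrt_nonneg _)
        _ = d * L := by rw [mul_assoc, Real.mul_self_sqrt hL0.le]
    have e1 : L ^ n = Real.exp ((n : ℝ) * Real.log L) := by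
      rw [← Real.exp_log (pow_pos hL0 n), Real.log_pow]
    have e2 : x ^ d = Real.exp (d * L) := by rw [Real.rpow_def_of_pos hx0, hL]; ring_nf
    rw [e1, e2]
    exact Real.exp_le_exp.mpr hkey

/-! ### The parameters `u`, `K = ⌊u²⁰⌋` -/

section Params

variable {u K : ℝ}

/-- Basic facts on `K` with `u²⁰/2 ≤ K ≤ u²⁰`, `u ≥ 2`. [folklore] -/
theorem params_K_pos (hu : 2 ≤ u) (hK : u ^ (20 : ℕ) / 2 ≤ K) : 16 ≤ K := by
  have : (2 : ℝ) ^ (20 : ℕ) ≤ u ^ (20 : ℕ) := pow_le_pow_left₀ (by norm_num) hu 20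
  norm_num at this; linarith

/-- `K^t ≤ u^{20t}` for `K ≤ u^{20}`, `t ≥ 0`. [folklore] -/
theorem params_K_rpow_le (hu : 2 ≤ u) (hK : u ^ (20 : ℕ) / 2 ≤ K) (hKu : K ≤ u ^ (20 : ℕ))
    {t : ℝ} (ht : 0 ≤ t) : K ^ t ≤ u ^ (20 * t) := by
  have hu0 : 0 ≤ u := by linarith
  have hK0 : 0 ≤ K := by linarith [params_K_pos hu hK]
  calc K ^ t ≤ (u ^ (20 : ℕ)) ^ t := Real.rpow_le_rpow hK0 hKu ht
    _ = u ^ (20 * t) := by rw [← Real.rpow_natCast, ← Real.rpow_mul hu0]; norm_num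

/-- `K^{-1/2} ≤ 2 u^{-10}` for `K ≥ u^{20}/2`. [folklore] -/
theorem params_K_inv_sqrt_le (hu : 2 ≤ u) (hK : u ^ (20 : ℕ) / 2 ≤ K) :
    K ^ (-(1 / 2 : ℝ)) ≤ 2 * u ^ (-(10 : ℝ)) := by
  have hu0 : 0 < u := by linarith
  have hK16 := params_K_pos hu hK
  have h0 : 0 < u ^ (20 : ℕ) / 2 := by positivity
  calc K ^ (-(1 / 2 : ℝ)) ≤ (u ^ (20 : ℕ) / 2) ^ (-(1 / 2 : ℝ)) :=
        Real.rpow_le_rpow_of_nonpos h0 hK (by norm_num)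
    _ = (u ^ (20 : ℕ)) ^ (-(1 / 2 : ℝ)) * (2 : ℝ) ^ (1 / 2 : ℝ) := by
        rw [Real.div_rpow (by positivity) (by norm_num), Real.rpow_neg (by norm_num : (0:ℝ) ≤ 2),
          div_eq_mul_inv, inv_inv]
    _ = u ^ (-(10 : ℝ)) * (2 : ℝ) ^ (1 / 2 : ℝ) := by
        rw [← Real.rpow_natCast, ← Real.rpow_mul hu0.le]; norm_num
    _ ≤ u ^ (-(10 : ℝ)) * 2 := by
        apply mul_le_mul_of_nonneg_left _ (by positivity)
        calc (2 : ℝ) ^ (1 / 2 : ℝ) ≤ 2 ^ (1 : ℝ) := Real.rpow_le_rpow_of_exponent_le (by norm_num) (by norm_num)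
          _ = 2 := Real.rpow_one 2
    _ = 2 * u ^ (-(10 : ℝ)) := by ring

/-- `1/K ≤ 2 u^{-20}` for `K ≥ u^{20}/2`. [folklore] -/
theorem params_K_inv_le (hu : 2 ≤ u) (hK : u ^ (20 : ℕ) / 2 ≤ K) :
    1 / K ≤ 2 * u ^ (-(20 : ℝ)) := by
  have hu0 : 0 < u := by linarith
  have hK16 := params_K_pos hu hK
  have h0 : 0 < u ^ (20 : ℕ) / 2 := by positivity
  rw [Real.rpow_neg hu0.le, show (20 : ℝ) = ((20 : ℕ) : ℝ) by norm_num, Real.rpow_natCast]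
  rw [div_le_iff₀ (by linarith), show 2 * (u ^ (20 : ℕ))⁻¹ * K = 2 * K / u ^ (20 : ℕ) by ring,
    le_div_iff₀ (by positivity)]
  linarith

/-- `K^{ε} ≤ u^{1/500}` for `0 ≤ ε ≤ 10⁻⁴`. [folklore] -/
theorem params_K_rpow_small (hu : 2 ≤ u) (hK : u ^ (20 : ℕ) / 2 ≤ K) (hKu : K ≤ u ^ (20 : ℕ))
    {ε c : ℝ} (hc : 0 ≤ c) (hε : c * ε ≤ 1 / 10000 * c) :
    K ^ (c * ε) ≤ u ^ (c / 500) := by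
  have hK1 : 1 ≤ K := by linarith [params_K_pos hu hK]
  calc K ^ (c * ε) ≤ K ^ (c / 10000) := Real.rpow_le_rpow_of_exponent_le hK1 (by linarith)
    _ ≤ u ^ (20 * (c / 10000)) := params_K_rpow_le hu hK hKu (by positivity)
    _ = u ^ (c / 500) := by ring_nf

/-- `u^{a} ≤ u^{b}` bookkeeping: for `u ≥ 1`. [folklore] -/
theorem params_u_mono (hu : 1 ≤ u) {a b : ℝ} (hab : a ≤ b) : u ^ a ≤ u ^ b :=
  Real.rpow_le_rpow_of_exponent_le hu hab

variable {L₀ y Qs α C_y C : ℝ}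

/-- **Smallness of `N₁`** (the Proposition 3 term). [cite: Harper2016, §4, p. 17 (end of the proof of Prop. 3)] -/
theorem small_N1 (hL : 2 ≤ L₀) (hu : L₀ ^ 2 ≤ u) (hK : u ^ (20 : ℕ) / 2 ≤ K) (hKu : K ≤ u ^ (20 : ℕ))
    (hQs : Qs = K ^ 2) (hα : 1 - 1 / 10000 ≤ α) (hα1 : α ≤ 1) (hy1 : 1 ≤ y)
    (hyε : y ^ (1 - α) ≤ C_y * L₀ ^ 2) (hC_y : 1 ≤ C_y) (hC : 0 ≤ C)
    (hbig : 48 * C * C_y ^ (7 / 2 : ℝ) ≤ L₀ ^ 5) :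
    C * (L₀ ^ 4 * (y * K) ^ (1 - α) * y ^ (5 / 2 * (1 - α)) *
      (K ^ (1 / 2 - α) + Real.sqrt K * Qs ^ (-(1 / 2 : ℝ) + 3 / 2 * (1 - α)))) ≤
      L₀ ^ 2 * u ^ (-(2 : ℝ)) / 12 := by
  have hu4 : 4 ≤ u := le_trans (by nlinarith) hu
  have hu2 : 2 ≤ u := by linarith
  have hu1 : 1 ≤ u := by linarith
  have hu0 : 0 < u := by linarith
  have hL1 : 1 ≤ L₀ := by linarith
  have hL0 : 0 < L₀ := by linarith
  have hK16 := params_K_pos hu2 hK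
  have hK0 : 0 < K := by linarith
  have hy0 : 0 < y := by linarith
  set ε := 1 - α with hε
  have hε0 : 0 ≤ ε := by rw [hε]; linarith
  have hε4 : ε ≤ 1 / 10000 := by rw [hε]; linarith
  set Λ := C_y * L₀ ^ 2 with hΛ
  have hΛ1 : 1 ≤ Λ := by rw [hΛ]; nlinarith
  have hΛ0 : 0 < Λ := by linarith
  -- the pieces
  have hKε : K ^ ε ≤ u ^ (1 / 500 : ℝ) := by
    have := params_K_rpow_small hu2 hK hKu (c := 1) (ε := ε) zero_le_one (by linarith)
    rwa [one_mul, show (1 : ℝ) / 500 = 1 / 500 from rfl] at this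
  have hK3ε : K ^ (3 * ε) ≤ u ^ (3 / 500 : ℝ) :=
    params_K_rpow_small hu2 hK hKu (c := 3) (by norm_num) (by linarith)
  have hKinv : K ^ (-(1 / 2 : ℝ)) ≤ 2 * u ^ (-(10 : ℝ)) := params_K_inv_sqrt_le hu2 hK
  have hyKε : (y * K) ^ ε ≤ Λ * u ^ (1 / 500 : ℝ) := by
    rw [Real.mul_rpow hy0.le hK0.le]
    exact mul_le_mul hyε hKε (by positivity) hΛ0.le
  have hy52 : y ^ (5 / 2 * ε) ≤ Λ ^ (5 / 2 : ℝ) := by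
    rw [mul_comm, Real.rpow_mul hy0.le]
    exact Real.rpow_le_rpow (by positivity) hyε (by norm_num)
  have hT1 : K ^ (1 / 2 - α) ≤ u ^ (3 / 500 : ℝ) * (2 * u ^ (-(10 : ℝ))) := by
    have e : (1 : ℝ) / 2 - α = ε + -(1 / 2 : ℝ) := by rw [hε]; ring
    rw [e, Real.rpow_add hK0]
    refine mul_le_mul (hKε.trans (params_u_mono hu1 (by norm_num))) hKinv (by positivity) (by positivity)
  have hT2 : Real.sqrt K * Qs ^ (-(1 / 2 : ℝ) + 3 / 2 * (1 - α)) ≤ u ^ (3 / 500 : ℝ) * (2 * u ^ (-(10 : ℝ))) := by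
    have e1 : Qs ^ (-(1 / 2 : ℝ) + 3 / 2 * (1 - α)) = K ^ (-1 + 3 * ε) := by
      rw [hQs, show (K ^ 2 : ℝ) = K ^ (2 : ℝ) by norm_cast, ← Real.rpow_mul hK0.le]
      congr 1; rw [hε]; ring
    have e2 : Real.sqrt K * K ^ (-1 + 3 * ε) = K ^ (3 * ε) * K ^ (-(1 / 2 : ℝ)) := by
      rw [Real.sqrt_eq_rpow, ← Real.rpow_add hK0, ← Real.rpow_add hK0]; congr 1; ring
    rw [e1, e2]
    exact mul_le_mul hK3ε hKinv (by positivity) (by positivity)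
  -- assemble `N1 ≤ 4 Λ^{7/2} L₀^4 u^{-9}`
  have hbr : K ^ (1 / 2 - α) + Real.sqrt K * Qs ^ (-(1 / 2 : ℝ) + 3 / 2 * (1 - α)) ≤
      4 * (u ^ (3 / 500 : ℝ) * u ^ (-(10 : ℝ))) := by linarith
  have hQs0 : 0 ≤ Qs := by rw [hQs]; positivity
  have hbr0 : 0 ≤ K ^ (1 / 2 - α) + Real.sqrt K * Qs ^ (-(1 / 2 : ℝ) + 3 / 2 * (1 - α)) := by positivity
  have hprod : (y * K) ^ ε * y ^ (5 / 2 * ε) *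
      (K ^ (1 / 2 - α) + Real.sqrt K * Qs ^ (-(1 / 2 : ℝ) + 3 / 2 * (1 - α))) ≤
      (Λ * u ^ (1 / 500 : ℝ)) * Λ ^ (5 / 2 : ℝ) * (4 * (u ^ (3 / 500 : ℝ) * u ^ (-(10 : ℝ)))) := by
    apply mul_le_mul (mul_le_mul hyKε hy52 (by positivity) (by positivity)) hbr hbr0 (by positivity)
  have hupow : u ^ (1 / 500 : ℝ) * (u ^ (3 / 500 : ℝ) * u ^ (-(10 : ℝ))) ≤ u ^ (-(2 : ℝ)) * u ^ (-(7 : ℝ)) := by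
    rw [← Real.rpow_add hu0, ← Real.rpow_add hu0, ← Real.rpow_add hu0]
    exact params_u_mono hu1 (by norm_num)
  have hΛpow : Λ * Λ ^ (5 / 2 : ℝ) = C_y ^ (7 / 2 : ℝ) * L₀ ^ (7 : ℕ) := by
    have e1 : Λ * Λ ^ (5 / 2 : ℝ) = Λ ^ (7 / 2 : ℝ) := by
      rw [show (7 : ℝ) / 2 = 1 + 5 / 2 by norm_num, Real.rpow_add hΛ0, Real.rpow_one]
    have hC0 : 0 ≤ C_y := by linarith
    rw [e1, hΛ, Real.mul_rpow hC0 (by positivity)]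
    congr 1
    rw [show ((L₀ ^ 2 : ℝ)) = L₀ ^ (2 : ℝ) by norm_cast, ← Real.rpow_mul hL0.le,
      show (2 : ℝ) * (7 / 2) = ((7 : ℕ) : ℝ) by norm_num, Real.rpow_natCast]
  -- `u^{-7} ≤ L₀^{-14}`
  have hu7 : u ^ (-(7 : ℝ)) ≤ (L₀ ^ (14 : ℕ))⁻¹ := by
    rw [Real.rpow_neg hu0.le, show (7 : ℝ) = ((7 : ℕ) : ℝ) by norm_num, Real.rpow_natCast]
    apply inv_anti₀ (by positivity)
    calc L₀ ^ (14 : ℕ) = (L₀ ^ 2) ^ (7 : ℕ) := by ring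
      _ ≤ u ^ (7 : ℕ) := pow_le_pow_left₀ (by positivity) hu 7
  have hL14 : 0 < L₀ ^ (14 : ℕ) := by positivity
  -- final
  have hmain : C * (L₀ ^ 4 * (y * K) ^ ε * y ^ (5 / 2 * ε) *
      (K ^ (1 / 2 - α) + Real.sqrt K * Qs ^ (-(1 / 2 : ℝ) + 3 / 2 * (1 - α)))) ≤
      C * (L₀ ^ 4 * (4 * (C_y ^ (7 / 2 : ℝ) * L₀ ^ (7 : ℕ)) * (u ^ (-(2 : ℝ)) * (L₀ ^ (14 : ℕ))⁻¹))) := by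
    apply mul_le_mul_of_nonneg_left _ hC
    rw [mul_assoc, mul_assoc]
    apply mul_le_mul_of_nonneg_left _ (by positivity)
    rw [← mul_assoc]
    refine hprod.trans ?_
    have : (Λ * u ^ (1 / 500 : ℝ)) * Λ ^ (5 / 2 : ℝ) * (4 * (u ^ (3 / 500 : ℝ) * u ^ (-(10 : ℝ)))) =
        4 * (Λ * Λ ^ (5 / 2 : ℝ)) * (u ^ (1 / 500 : ℝ) * (u ^ (3 / 500 : ℝ) * u ^ (-(10 : ℝ)))) := by ring
    rw [this, hΛpow]
    have h2 : u ^ (1 / 500 : ℝ) * (u ^ (3 / 500 : ℝ) * u ^ (-(10 : ℝ))) ≤ u ^ (-(2 : ℝ)) * (L₀ ^ (14 : ℕ))⁻¹ :=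
      hupow.trans (mul_le_mul_of_nonneg_left hu7 (by positivity))
    calc 4 * (C_y ^ (7 / 2 : ℝ) * L₀ ^ (7 : ℕ)) * (u ^ (1 / 500 : ℝ) * (u ^ (3 / 500 : ℝ) * u ^ (-(10 : ℝ))))
        ≤ 4 * (C_y ^ (7 / 2 : ℝ) * L₀ ^ (7 : ℕ)) * (u ^ (-(2 : ℝ)) * (L₀ ^ (14 : ℕ))⁻¹) :=
          mul_le_mul_of_nonneg_left h2 (by positivity)
      _ = 4 * (C_y ^ (7 / 2 : ℝ) * L₀ ^ (7 : ℕ)) * (u ^ (-(2 : ℝ)) * (L₀ ^ (14 : ℕ))⁻¹) := rfl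
  refine hmain.trans ?_
  -- `C L₀^4 · 4 C_y^{7/2} L₀^7 u^{-2} L₀^{-14} ≤ L₀² u^{-2}/12` iff `48 C C_y^{7/2} ≤ L₀^5`
  have e : C * (L₀ ^ 4 * (4 * (C_y ^ (7 / 2 : ℝ) * L₀ ^ (7 : ℕ)) * (u ^ (-(2 : ℝ)) * (L₀ ^ (14 : ℕ))⁻¹))) =
      (48 * C * C_y ^ (7 / 2 : ℝ)) * (L₀ ^ (11 : ℕ) * (L₀ ^ (14 : ℕ))⁻¹ * u ^ (-(2 : ℝ)) / 12) := by ring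
  rw [e]
  calc (48 * C * C_y ^ (7 / 2 : ℝ)) * (L₀ ^ (11 : ℕ) * (L₀ ^ (14 : ℕ))⁻¹ * u ^ (-(2 : ℝ)) / 12)
      ≤ L₀ ^ 5 * (L₀ ^ (11 : ℕ) * (L₀ ^ (14 : ℕ))⁻¹ * u ^ (-(2 : ℝ)) / 12) :=
        mul_le_mul_of_nonneg_right hbig (by positivity)
    _ = L₀ ^ 2 * u ^ (-(2 : ℝ)) / 12 := by field_simp

/-- **Smallness of `K^{-α/2}`** (the `Ψ(A)` term, `A = x/√K`). [cite: Harper2016, §4, p. 16] -/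
theorem small_KA (hL : 2 ≤ L₀) (hu : L₀ ^ 2 ≤ u) (hK : u ^ (20 : ℕ) / 2 ≤ K) (hKu : K ≤ u ^ (20 : ℕ))
    (hα : 1 - 1 / 10000 ≤ α) (hC : 0 ≤ C) (hbig : 24 * C ≤ L₀ ^ 2) :
    C * K ^ (-(α / 2)) ≤ L₀ ^ 2 * u ^ (-(2 : ℝ)) / 12 := by
  have hu4 : 4 ≤ u := le_trans (by nlinarith) hu
  have hu2 : 2 ≤ u := by linarith
  have hu1 : 1 ≤ u := by linarith
  have hu0 : 0 < u := by linarith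
  have hK16 := params_K_pos hu2 hK
  have hK0 : 0 < K := by linarith
  set ε := 1 - α with hε
  have hKε : K ^ (1 / 2 * ε) ≤ u ^ ((1 / 2 : ℝ) / 500) :=
    params_K_rpow_small hu2 hK hKu (c := 1 / 2) (by norm_num) (by rw [hε]; linarith)
  have hKinv : K ^ (-(1 / 2 : ℝ)) ≤ 2 * u ^ (-(10 : ℝ)) := params_K_inv_sqrt_le hu2 hK
  have e : -(α / 2) = 1 / 2 * ε + -(1 / 2 : ℝ) := by rw [hε]; ring
  rw [e, Real.rpow_add hK0]
  have h1 : K ^ (1 / 2 * ε) * K ^ (-(1 / 2 : ℝ)) ≤ u ^ ((1 / 2 : ℝ) / 500) * (2 * u ^ (-(10 : ℝ))) :=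
    mul_le_mul hKε hKinv (by positivity) (by positivity)
  have h2 : u ^ ((1 / 2 : ℝ) / 500) * (2 * u ^ (-(10 : ℝ))) ≤ 2 * u ^ (-(2 : ℝ)) := by
    rw [show u ^ ((1 / 2 : ℝ) / 500) * (2 * u ^ (-(10 : ℝ))) = 2 * (u ^ ((1 / 2 : ℝ) / 500) * u ^ (-(10 : ℝ))) by ring,
      ← Real.rpow_add hu0]
    exact mul_le_mul_of_nonneg_left (params_u_mono hu1 (by norm_num)) (by norm_num)
  have hL2 : 0 < L₀ ^ 2 := by positivity
  calc C * (K ^ (1 / 2 * ε) * K ^ (-(1 / 2 : ℝ))) ≤ C * (2 * u ^ (-(2 : ℝ))) :=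
        mul_le_mul_of_nonneg_left (h1.trans h2) hC
    _ = (24 * C) * u ^ (-(2 : ℝ)) / 12 := by ring
    _ ≤ L₀ ^ 2 * u ^ (-(2 : ℝ)) / 12 := by
        apply div_le_div_of_nonneg_right _ (by norm_num)
        exact mul_le_mul_of_nonneg_right hbig (by positivity)

/-- `log K ≤ 20 u`. [folklore] -/
theorem params_log_K_le (hu : 2 ≤ u) (hK : u ^ (20 : ℕ) / 2 ≤ K) (hKu : K ≤ u ^ (20 : ℕ)) :
    Real.log K ≤ 20 * u := by
  have hu0 : 0 < u := by linarith
  have hK16 := params_K_pos hu hK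
  calc Real.log K ≤ Real.log (u ^ (20 : ℕ)) := Real.log_le_log (by linarith) hKu
    _ = 20 * Real.log u := by rw [Real.log_pow]; norm_num
    _ ≤ 20 * u := by
        have := Real.log_le_sub_one_of_pos hu0
        linarith

/-- **Smallness of `N₂`** (the easy-range term of Prop. 4). [cite: Harper2016, §4, p. 18] -/
theorem small_N2 (hL : 2 ≤ L₀) (hu : L₀ ^ 2 ≤ u) (hK : u ^ (20 : ℕ) / 2 ≤ K) (hKu : K ≤ u ^ (20 : ℕ))
    (hQs : Qs = K ^ 2) (hα : 1 - 1 / 10000 ≤ α) (hα1 : α ≤ 1) (hy1 : 1 ≤ y)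
    (hlogy : Real.log y ≤ L₀) (hyε : y ^ (1 - α) ≤ C_y * L₀ ^ 2) (hC_y : 1 ≤ C_y) (hC : 0 ≤ C)
    (hbig : 3936 * C * C_y ≤ L₀ ^ 30) :
    C * ((1 + Real.log y) ^ 2 * (1 + Real.log Qs) * Qs ^ (1 - α) * K ^ (-α) * y ^ (1 - α)) ≤
      L₀ ^ 2 * u ^ (-(2 : ℝ)) / 12 := by
  have hu4 : 4 ≤ u := le_trans (by nlinarith) hu
  have hu2 : 2 ≤ u := by linarith
  have hu1 : 1 ≤ u := by linarith
  have hu0 : 0 < u := by linarith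
  have hL1 : 1 ≤ L₀ := by linarith
  have hL0 : 0 < L₀ := by linarith
  have hK16 := params_K_pos hu2 hK
  have hK0 : 0 < K := by linarith
  have hy0 : 0 < y := by linarith
  have hlogy0 : 0 ≤ Real.log y := Real.log_nonneg hy1
  set ε := 1 - α with hε
  have hε0 : 0 ≤ ε := by rw [hε]; linarith
  set Λ := C_y * L₀ ^ 2 with hΛ
  have hΛ0 : 0 < Λ := by rw [hΛ]; positivity
  -- pieces
  have h1 : (1 + Real.log y) ^ 2 ≤ 4 * L₀ ^ 2 := by nlinarith
  have hlogK := params_log_K_le hu2 hK hKu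
  have h2 : 1 + Real.log Qs ≤ 41 * u := by
    rw [hQs, Real.log_pow]; push_cast; nlinarith
  have h2' : 0 ≤ 1 + Real.log Qs := by
    rw [hQs, Real.log_pow]; have := Real.log_nonneg (show (1 : ℝ) ≤ K by linarith); positivity
  have h3 : Qs ^ ε ≤ u ^ ((2 : ℝ) / 500) := by
    rw [hQs, show (K ^ 2 : ℝ) = K ^ (2 : ℝ) by norm_cast, ← Real.rpow_mul hK0.le]
    exact params_K_rpow_small hu2 hK hKu (c := 2) (by norm_num) (by linarith)
  have h4 : K ^ (-α) ≤ u ^ ((1 : ℝ) / 500) * (2 * u ^ (-(20 : ℝ))) := by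
    have e : -α = 1 * ε + -(1 : ℝ) := by rw [hε]; ring
    rw [e, Real.rpow_add hK0, Real.rpow_neg_one]
    refine mul_le_mul (params_K_rpow_small hu2 hK hKu (c := 1) (by norm_num) (by linarith)) ?_
      (by positivity) (by positivity)
    rw [← one_div]; exact params_K_inv_le hu2 hK
  -- product
  have hQs0 : 0 ≤ Qs := by rw [hQs]; positivity
  have hprod : (1 + Real.log y) ^ 2 * (1 + Real.log Qs) * Qs ^ ε * K ^ (-α) * y ^ ε ≤
      (4 * L₀ ^ 2) * (41 * u) * u ^ ((2 : ℝ) / 500) * (u ^ ((1 : ℝ) / 500) * (2 * u ^ (-(20 : ℝ)))) * Λ := by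
    apply mul_le_mul _ hyε (by positivity) (by positivity)
    apply mul_le_mul _ h4 (by positivity) (by positivity)
    apply mul_le_mul _ h3 (by positivity) (by positivity)
    exact mul_le_mul h1 h2 h2' (by positivity)
  have hupow : u * u ^ ((2 : ℝ) / 500) * (u ^ ((1 : ℝ) / 500) * u ^ (-(20 : ℝ))) ≤ u ^ (-(2 : ℝ)) * u ^ (-(16 : ℝ)) := by
    rw [show u * u ^ ((2 : ℝ) / 500) * (u ^ ((1 : ℝ) / 500) * u ^ (-(20 : ℝ))) =
      u ^ (1 : ℝ) * u ^ ((2 : ℝ) / 500) * (u ^ ((1 : ℝ) / 500) * u ^ (-(20 : ℝ))) by rw [Real.rpow_one],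
      ← Real.rpow_add hu0, ← Real.rpow_add hu0, ← Real.rpow_add hu0, ← Real.rpow_add hu0]
    exact params_u_mono hu1 (by norm_num)
  have hu16 : u ^ (-(16 : ℝ)) ≤ (L₀ ^ (32 : ℕ))⁻¹ := by
    rw [Real.rpow_neg hu0.le, show (16 : ℝ) = ((16 : ℕ) : ℝ) by norm_num, Real.rpow_natCast]
    apply inv_anti₀ (by positivity)
    calc L₀ ^ (32 : ℕ) = (L₀ ^ 2) ^ (16 : ℕ) := by ring
      _ ≤ u ^ (16 : ℕ) := pow_le_pow_left₀ (by positivity) hu 16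
  have hmain : C * ((1 + Real.log y) ^ 2 * (1 + Real.log Qs) * Qs ^ ε * K ^ (-α) * y ^ ε) ≤
      C * (328 * C_y * L₀ ^ 4 * (u ^ (-(2 : ℝ)) * (L₀ ^ (32 : ℕ))⁻¹)) := by
    apply mul_le_mul_of_nonneg_left _ hC
    refine hprod.trans ?_
    have e : (4 * L₀ ^ 2) * (41 * u) * u ^ ((2 : ℝ) / 500) * (u ^ ((1 : ℝ) / 500) * (2 * u ^ (-(20 : ℝ)))) * Λ =
        328 * C_y * L₀ ^ 4 * (u * u ^ ((2 : ℝ) / 500) * (u ^ ((1 : ℝ) / 500) * u ^ (-(20 : ℝ)))) := by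
      rw [hΛ]; ring
    rw [e]
    apply mul_le_mul_of_nonneg_left _ (by positivity)
    exact hupow.trans (mul_le_mul_of_nonneg_left hu16 (by positivity))
  refine hmain.trans ?_
  have e : C * (328 * C_y * L₀ ^ 4 * (u ^ (-(2 : ℝ)) * (L₀ ^ (32 : ℕ))⁻¹)) =
      (3936 * C * C_y) * (L₀ ^ 4 * (L₀ ^ (32 : ℕ))⁻¹ * u ^ (-(2 : ℝ)) / 12) := by ring
  rw [e]
  calc (3936 * C * C_y) * (L₀ ^ 4 * (L₀ ^ (32 : ℕ))⁻¹ * u ^ (-(2 : ℝ)) / 12)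
      ≤ L₀ ^ 30 * (L₀ ^ 4 * (L₀ ^ (32 : ℕ))⁻¹ * u ^ (-(2 : ℝ)) / 12) :=
        mul_le_mul_of_nonneg_right hbig (by positivity)
    _ = L₀ ^ 2 * u ^ (-(2 : ℝ)) / 12 := by field_simp

/-- **Smallness of `N₃`** (the hard-range term of Prop. 4). [cite: Harper2016, §4, p. 17] -/
theorem small_N3 (hL : 2 ≤ L₀) (hu : L₀ ^ 2 ≤ u) (hK : u ^ (20 : ℕ) / 2 ≤ K) (hKu : K ≤ u ^ (20 : ℕ))
    (hQs : Qs = K ^ 2) (hα : 1 - 1 / 10000 ≤ α) (hα1 : α ≤ 1) (hy1 : 1 ≤ y)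
    (hlogy : Real.log y ≤ L₀) (hyε : y ^ (1 - α) ≤ C_y * L₀ ^ 2) (hC_y : 1 ≤ C_y) (hC : 0 ≤ C)
    (hbig : 4392 * C * C_y ^ 2 ≤ L₀ ^ 28) :
    C * (Real.log y * (1 + Real.log Qs + Real.log K + Real.log (Qs ^ 2 * y * K ^ 2 + 1)) *
      y ^ (1 - α) * (Qs ^ 2 * y * K ^ 2) ^ (1 - α) / K) ≤
      L₀ ^ 2 * u ^ (-(2 : ℝ)) / 12 := by
  have hu4 : 4 ≤ u := le_trans (by nlinarith) hu
  have hu2 : 2 ≤ u := by linarith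
  have hu1 : 1 ≤ u := by linarith
  have hu0 : 0 < u := by linarith
  have hL1 : 1 ≤ L₀ := by linarith
  have hL0 : 0 < L₀ := by linarith
  have hK16 := params_K_pos hu2 hK
  have hK0 : 0 < K := by linarith
  have hK1 : 1 ≤ K := by linarith
  have hy0 : 0 < y := by linarith
  have hlogy0 : 0 ≤ Real.log y := Real.log_nonneg hy1
  set ε := 1 - α with hε
  have hε0 : 0 ≤ ε := by rw [hε]; linarith
  set Λ := C_y * L₀ ^ 2 with hΛ
  have hΛ0 : 0 < Λ := by rw [hΛ]; positivity
  have hlogK := params_log_K_le hu2 hK hKu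
  have hlogK0 : 0 ≤ Real.log K := Real.log_nonneg hK1
  -- the bracket `≤ 183 u L₀`
  have hB6 : Qs ^ 2 * y * K ^ 2 = K ^ 6 * y := by rw [hQs]; ring
  have hK6y : 1 ≤ K ^ 6 * y := one_le_mul_of_one_le_of_one_le (one_le_pow₀ hK1) hy1
  have hlog6 : Real.log (Qs ^ 2 * y * K ^ 2 + 1) ≤ 1 + 120 * u + L₀ := by
    rw [hB6]
    calc Real.log (K ^ 6 * y + 1) ≤ Real.log (2 * (K ^ 6 * y)) := Real.log_le_log (by positivity) (by linarith)
      _ = Real.log 2 + 6 * Real.log K + Real.log y := by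
          rw [Real.log_mul (by norm_num) (by positivity), Real.log_mul (by positivity) hy0.ne', Real.log_pow]
          push_cast; ring
      _ ≤ 1 + 120 * u + L₀ := by
          have := Real.log_two_lt_d9
          nlinarith
  have hbracket : 1 + Real.log Qs + Real.log K + Real.log (Qs ^ 2 * y * K ^ 2 + 1) ≤ 183 * u * L₀ := by
    rw [show Real.log Qs = 2 * Real.log K by rw [hQs, Real.log_pow]; norm_num]
    nlinarith
  have hbracket0 : 0 ≤ 1 + Real.log Qs + Real.log K + Real.log (Qs ^ 2 * y * K ^ 2 + 1) := by
    have h1 : 0 ≤ Real.log Qs := by rw [hQs, Real.log_pow]; positivity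
    have h2 : 0 ≤ Real.log (Qs ^ 2 * y * K ^ 2 + 1) := Real.log_nonneg (by rw [hB6]; linarith)
    positivity
  -- the powers
  have hpow6 : (Qs ^ 2 * y * K ^ 2) ^ ε ≤ u ^ ((6 : ℝ) / 500) * Λ := by
    rw [hB6, Real.mul_rpow (by positivity) hy0.le]
    refine mul_le_mul ?_ hyε (by positivity) (by positivity)
    rw [show (K ^ 6 : ℝ) = K ^ (6 : ℝ) by norm_cast, ← Real.rpow_mul hK0.le]
    exact params_K_rpow_small hu2 hK hKu (c := 6) (by norm_num) (by linarith)
  have hKinv : 1 / K ≤ 2 * u ^ (-(20 : ℝ)) := params_K_inv_le hu2 hK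
  -- product: write `X / K = X * (1/K)`
  rw [div_eq_mul_one_div _ K]
  have hprod : Real.log y * (1 + Real.log Qs + Real.log K + Real.log (Qs ^ 2 * y * K ^ 2 + 1)) *
      y ^ ε * (Qs ^ 2 * y * K ^ 2) ^ ε * (1 / K) ≤
      L₀ * (183 * u * L₀) * Λ * (u ^ ((6 : ℝ) / 500) * Λ) * (2 * u ^ (-(20 : ℝ))) := by
    have hQs0 : 0 ≤ Qs := by rw [hQs]; positivity
    apply mul_le_mul _ hKinv (by positivity) (by positivity)
    apply mul_le_mul _ hpow6 (by positivity) (by positivity)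
    apply mul_le_mul _ hyε (by positivity) (by positivity)
    exact mul_le_mul hlogy hbracket hbracket0 hL0.le
  have hupow : u * u ^ ((6 : ℝ) / 500) * u ^ (-(20 : ℝ)) ≤ u ^ (-(2 : ℝ)) * u ^ (-(16 : ℝ)) := by
    rw [show u * u ^ ((6 : ℝ) / 500) * u ^ (-(20 : ℝ)) = u ^ (1 : ℝ) * u ^ ((6 : ℝ) / 500) * u ^ (-(20 : ℝ)) by
      rw [Real.rpow_one], ← Real.rpow_add hu0, ← Real.rpow_add hu0, ← Real.rpow_add hu0]
    exact params_u_mono hu1 (by norm_num)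
  have hu16 : u ^ (-(16 : ℝ)) ≤ (L₀ ^ (32 : ℕ))⁻¹ := by
    rw [Real.rpow_neg hu0.le, show (16 : ℝ) = ((16 : ℕ) : ℝ) by norm_num, Real.rpow_natCast]
    apply inv_anti₀ (by positivity)
    calc L₀ ^ (32 : ℕ) = (L₀ ^ 2) ^ (16 : ℕ) := by ring
      _ ≤ u ^ (16 : ℕ) := pow_le_pow_left₀ (by positivity) hu 16
  have hmain : C * (Real.log y * (1 + Real.log Qs + Real.log K + Real.log (Qs ^ 2 * y * K ^ 2 + 1)) *
      y ^ ε * (Qs ^ 2 * y * K ^ 2) ^ ε * (1 / K)) ≤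
      C * (366 * C_y ^ 2 * L₀ ^ 6 * (u ^ (-(2 : ℝ)) * (L₀ ^ (32 : ℕ))⁻¹)) := by
    apply mul_le_mul_of_nonneg_left _ hC
    refine hprod.trans ?_
    have e : L₀ * (183 * u * L₀) * Λ * (u ^ ((6 : ℝ) / 500) * Λ) * (2 * u ^ (-(20 : ℝ))) =
        366 * C_y ^ 2 * L₀ ^ 6 * (u * u ^ ((6 : ℝ) / 500) * u ^ (-(20 : ℝ))) := by rw [hΛ]; ring
    rw [e]
    apply mul_le_mul_of_nonneg_left _ (by positivity)
    exact hupow.trans (mul_le_mul_of_nonneg_left hu16 (by positivity))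
  refine hmain.trans ?_
  have e : C * (366 * C_y ^ 2 * L₀ ^ 6 * (u ^ (-(2 : ℝ)) * (L₀ ^ (32 : ℕ))⁻¹)) =
      (4392 * C * C_y ^ 2) * (L₀ ^ 6 * (L₀ ^ (32 : ℕ))⁻¹ * u ^ (-(2 : ℝ)) / 12) := by ring
  rw [e]
  calc (4392 * C * C_y ^ 2) * (L₀ ^ 6 * (L₀ ^ (32 : ℕ))⁻¹ * u ^ (-(2 : ℝ)) / 12)
      ≤ L₀ ^ 28 * (L₀ ^ 6 * (L₀ ^ (32 : ℕ))⁻¹ * u ^ (-(2 : ℝ)) / 12) :=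
        mul_le_mul_of_nonneg_right hbig (by positivity)
    _ = L₀ ^ 2 * u ^ (-(2 : ℝ)) / 12 := by field_simp

variable {x 𝓟 : ℝ}

/-- **Smallness of `x^{19/20}/𝓟`** (the crude leftover of Prop. 3), given `𝓟 ≥ x^{24/25}`. [folklore] -/
theorem small_x1920 (hx : 1 < x) (hL1 : 1 ≤ L₀) (hu0 : 0 < u) (hux : u ≤ x ^ ((1 : ℝ) / 20000))
    (h𝓟 : x ^ ((24 : ℝ) / 25) ≤ 𝓟) (hC : 0 ≤ C) (hbig : 12 * C ≤ x ^ ((99 : ℝ) / 10000)) :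
    C * (x ^ ((19 : ℝ) / 20) / 𝓟) ≤ L₀ ^ 2 * u ^ (-(2 : ℝ)) / 12 := by
  have hx0 : 0 < x := by linarith
  have h𝓟0 : 0 < 𝓟 := lt_of_lt_of_le (by positivity) h𝓟
  have h1 : x ^ ((19 : ℝ) / 20) / 𝓟 ≤ x ^ (-((1 : ℝ) / 100)) := by
    rw [div_le_iff₀ h𝓟0]
    calc x ^ ((19 : ℝ) / 20) = x ^ (-((1 : ℝ) / 100)) * x ^ ((24 : ℝ) / 25) := by
          rw [← Real.rpow_add hx0]; norm_num
      _ ≤ x ^ (-((1 : ℝ) / 100)) * 𝓟 := mul_le_mul_of_nonneg_left h𝓟 (by positivity)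
  have h2 : x ^ (-((1 : ℝ) / 10000)) ≤ u ^ (-(2 : ℝ)) := by
    calc x ^ (-((1 : ℝ) / 10000)) = (x ^ ((1 : ℝ) / 20000)) ^ (-(2 : ℝ)) := by
          rw [← Real.rpow_mul hx0.le]; norm_num
      _ ≤ u ^ (-(2 : ℝ)) := Real.rpow_le_rpow_of_nonpos hu0 hux (by norm_num)
  have h3 : 12 * C * x ^ (-((1 : ℝ) / 100)) ≤ x ^ (-((1 : ℝ) / 10000)) := by
    calc 12 * C * x ^ (-((1 : ℝ) / 100)) ≤ x ^ ((99 : ℝ) / 10000) * x ^ (-((1 : ℝ) / 100)) :=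
          mul_le_mul_of_nonneg_right hbig (by positivity)
      _ = x ^ (-((1 : ℝ) / 10000)) := by rw [← Real.rpow_add hx0]; norm_num
  have hL2 : 1 ≤ L₀ ^ 2 := one_le_pow₀ hL1
  calc C * (x ^ ((19 : ℝ) / 20) / 𝓟) ≤ C * x ^ (-((1 : ℝ) / 100)) := mul_le_mul_of_nonneg_left h1 hC
    _ = (12 * C * x ^ (-((1 : ℝ) / 100))) / 12 := by ring
    _ ≤ x ^ (-((1 : ℝ) / 10000)) / 12 := by gcongr
    _ ≤ u ^ (-(2 : ℝ)) / 12 := by gcongr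
    _ = 1 * u ^ (-(2 : ℝ)) / 12 := by ring
    _ ≤ L₀ ^ 2 * u ^ (-(2 : ℝ)) / 12 := by gcongr

/-- **Smallness of `M (1 + log x) Q⋆/x`** (the second term of Harmonic Analysis Result 2). [folklore] -/
theorem small_MQ (hx : 1 < x) (hLx : Real.log x ≤ L₀) (hL : 2 ≤ L₀) (hu : L₀ ^ 2 ≤ u)
    (hK : u ^ (20 : ℕ) / 2 ≤ K) (hKu : K ≤ u ^ (20 : ℕ))
    (hQs : Qs = K ^ 2) (hα : 1 - 1 / 10000 ≤ α) (hα1 : α ≤ 1) (hy1 : 1 ≤ y)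
    (hlogy : Real.log y ≤ L₀) (hyε : y ^ (1 - α) ≤ C_y * L₀ ^ 2) (hC_y : 1 ≤ C_y) (hC : 0 ≤ C)
    (hux : u ≤ x ^ ((1 : ℝ) / 20000)) (hbig : 96 * C * C_y * L₀ ^ 3 ≤ x ^ ((19957 : ℝ) / 20000)) :
    C * ((1 + Real.log y) ^ 2 * (Qs * y * K) ^ (1 - α) * (1 + Real.log x) * Qs / x) ≤
      L₀ ^ 2 * u ^ (-(2 : ℝ)) / 12 := by
  have hx0 : 0 < x := by linarith
  have hu4 : 4 ≤ u := le_trans (by nlinarith) hu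
  have hu2 : 2 ≤ u := by linarith
  have hu1 : 1 ≤ u := by linarith
  have hu0 : 0 < u := by linarith
  have hL1 : 1 ≤ L₀ := by linarith
  have hL0 : 0 < L₀ := by linarith
  have hK16 := params_K_pos hu2 hK
  have hK0 : 0 < K := by linarith
  have hy0 : 0 < y := by linarith
  have hlogy0 : 0 ≤ Real.log y := Real.log_nonneg hy1
  have hlogx0 : 0 ≤ Real.log x := Real.log_nonneg hx.le
  set ε := 1 - α with hε
  have hε0 : 0 ≤ ε := by rw [hε]; linarith
  set Λ := C_y * L₀ ^ 2 with hΛ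
  have hΛ0 : 0 < Λ := by rw [hΛ]; positivity
  have h1 : (1 + Real.log y) ^ 2 ≤ 4 * L₀ ^ 2 := by nlinarith
  have h2 : (Qs * y * K) ^ ε ≤ u ^ ((3 : ℝ) / 500) * Λ := by
    rw [show Qs * y * K = K ^ 3 * y by rw [hQs]; ring, Real.mul_rpow (by positivity) hy0.le]
    refine mul_le_mul ?_ hyε (by positivity) (by positivity)
    rw [show (K ^ 3 : ℝ) = K ^ (3 : ℝ) by norm_cast, ← Real.rpow_mul hK0.le]
    exact params_K_rpow_small hu2 hK hKu (c := 3) (by norm_num) (by linarith)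
  have h3 : 1 + Real.log x ≤ 2 * L₀ := by linarith
  have h4 : Qs ≤ u ^ (40 : ℕ) := by
    rw [hQs]
    calc K ^ 2 ≤ (u ^ (20 : ℕ)) ^ 2 := pow_le_pow_left₀ hK0.le hKu 2
      _ = u ^ (40 : ℕ) := by ring
  have hQs0 : 0 ≤ Qs := by rw [hQs]; positivity
  have hprod : (1 + Real.log y) ^ 2 * (Qs * y * K) ^ ε * (1 + Real.log x) * Qs ≤
      (4 * L₀ ^ 2) * (u ^ ((3 : ℝ) / 500) * Λ) * (2 * L₀) * u ^ (40 : ℕ) := by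
    apply mul_le_mul _ h4 hQs0 (by positivity)
    apply mul_le_mul _ h3 (by positivity) (by positivity)
    exact mul_le_mul h1 h2 (by positivity) (by positivity)
  -- `u^{3/500} u^{40} u^{2} ≤ u^{43} ≤ x^{43/20000}`
  have hupow : u ^ ((3 : ℝ) / 500) * u ^ (40 : ℕ) ≤ x ^ ((43 : ℝ) / 20000) * u ^ (-(2 : ℝ)) := by
    have e1 : u ^ ((3 : ℝ) / 500) * u ^ (40 : ℕ) = (u ^ ((3 : ℝ) / 500) * u ^ (40 : ℕ) * u ^ (2 : ℝ)) * u ^ (-(2 : ℝ)) := by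
      rw [mul_assoc, ← Real.rpow_add hu0]; norm_num
    rw [e1]
    apply mul_le_mul_of_nonneg_right _ (by positivity)
    have e2 : u ^ ((3 : ℝ) / 500) * u ^ (40 : ℕ) * u ^ (2 : ℝ) ≤ u ^ (43 : ℝ) := by
      rw [show (u ^ (40 : ℕ) : ℝ) = u ^ ((40 : ℕ) : ℝ) by rw [Real.rpow_natCast], ← Real.rpow_add hu0,
        ← Real.rpow_add hu0]
      exact params_u_mono hu1 (by norm_num)
    refine e2.trans ?_
    calc u ^ (43 : ℝ) ≤ (x ^ ((1 : ℝ) / 20000)) ^ (43 : ℝ) := Real.rpow_le_rpow hu0.le hux (by norm_num)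
      _ = x ^ ((43 : ℝ) / 20000) := by rw [← Real.rpow_mul hx0.le]; norm_num
  have hmain : C * ((1 + Real.log y) ^ 2 * (Qs * y * K) ^ ε * (1 + Real.log x) * Qs / x) ≤
      C * (8 * C_y * L₀ ^ 5 * (x ^ ((43 : ℝ) / 20000) * u ^ (-(2 : ℝ))) / x) := by
    apply mul_le_mul_of_nonneg_left _ hC
    apply div_le_div_of_nonneg_right _ hx0.le
    refine hprod.trans ?_
    have e : (4 * L₀ ^ 2) * (u ^ ((3 : ℝ) / 500) * Λ) * (2 * L₀) * u ^ (40 : ℕ) =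
        8 * C_y * L₀ ^ 5 * (u ^ ((3 : ℝ) / 500) * u ^ (40 : ℕ)) := by rw [hΛ]; ring
    rw [e]
    exact mul_le_mul_of_nonneg_left hupow (by positivity)
  refine hmain.trans ?_
  have e : C * (8 * C_y * L₀ ^ 5 * (x ^ ((43 : ℝ) / 20000) * u ^ (-(2 : ℝ))) / x) =
      (96 * C * C_y * L₀ ^ 3) * x ^ ((43 : ℝ) / 20000) / x * (L₀ ^ 2 * u ^ (-(2 : ℝ)) / 12) := by
    field_simp; ring
  rw [e]
  have hfac : (96 * C * C_y * L₀ ^ 3) * x ^ ((43 : ℝ) / 20000) / x ≤ 1 := by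
    rw [div_le_one hx0]
    calc (96 * C * C_y * L₀ ^ 3) * x ^ ((43 : ℝ) / 20000) ≤ x ^ ((19957 : ℝ) / 20000) * x ^ ((43 : ℝ) / 20000) :=
          mul_le_mul_of_nonneg_right hbig (by positivity)
      _ = x := by rw [← Real.rpow_add hx0]; norm_num
  calc (96 * C * C_y * L₀ ^ 3) * x ^ ((43 : ℝ) / 20000) / x * (L₀ ^ 2 * u ^ (-(2 : ℝ)) / 12)
      ≤ 1 * (L₀ ^ 2 * u ^ (-(2 : ℝ)) / 12) := mul_le_mul_of_nonneg_right hfac (by positivity)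
    _ = L₀ ^ 2 * u ^ (-(2 : ℝ)) / 12 := one_mul _

end Params

/-! ### The large-values count -/

set_option maxHeartbeats 8000000 in
-- a long assembly
/-- **The large-values count** (Harper (4.1) with explicit parameters). See the module docstring.
[cite: Harper2016, §4, (4.1) and p. 18] -/
theorem largeValues_count_le :
    ∃ C x₀ : ℝ, 0 < C ∧ ∀ (x : ℝ) (y : ℕ), x₀ ≤ x → Real.log x ^ 8 ≤ y →
      Real.log y ≤ 1 / 2 * Real.log x ^ (1 / 6 : ℝ) → (y : ℝ) ^ 200 ≤ x →
      1 - 1 / 10000 ≤ saddlePoint x y →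
      x ^ ((24 : ℝ) / 25) ≤ x ^ saddlePoint x y *
        (smoothZeta (saddlePoint x y) y / Real.sqrt (saddlePhi₂ (saddlePoint x y) y)) →
      ∀ {ι : Type*} (T : Finset ι) (θ : ι → ℝ),
        (∀ i ∈ T, ∀ j ∈ T, i ≠ j → ∀ k : ℤ, 1 / x ≤ |θ j - θ i - k|) →
      ∀ (a : ℕ → ℂ), (∀ n, ‖a n‖ ≤ 1) → ∀ (δ : ℝ), Real.log x * x ^ (-((1 : ℝ) / 20000)) ≤ δ → δ ≤ 1 →
        (∀ r ∈ T, δ * (x ^ saddlePoint x y *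
            (smoothZeta (saddlePoint x y) y / Real.sqrt (saddlePhi₂ (saddlePoint x y) y))) ≤
          ‖∑ n ∈ Nat.smoothNumbersUpTo ⌊x⌋₊ (y + 1), a n * (𝐞 ((n : ℝ) * θ r) : ℂ)‖) →
        (T.card : ℝ) ≤ C * Real.log x ^ (19 : ℕ) * δ ^ (-((49 : ℝ) / 20)) := by
  classical
  obtain ⟨C_LV, x₀LV, hC_LV, hLV⟩ := largeValues_ineq
  obtain ⟨C_y0, x₀y, hC_y0, hyb⟩ := rpow_one_sub_saddlePoint_le
  obtain ⟨x₀1, hlt1⟩ := saddlePoint_lt_one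
  set C_y : ℝ := max C_y0 1 with hC_ydef
  have hC_y1 : 1 ≤ C_y := le_max_right _ _
  have hC_yge : C_y0 ≤ C_y := le_max_left _ _
  have hC_y0' : 0 < C_y := by linarith
  set A : ℝ := 8 * 2 ^ ((23 : ℝ) / 2) * C_LV * C_y with hA
  have hA0 : 0 < A := by positivity
  -- the threshold: `L₀ = log x ≥ M`
  set M : ℝ := 6400000000 + 1300 * C_LV + 48 * C_LV * C_y ^ ((7 : ℝ) / 2) + 4392 * C_LV * C_y ^ 2 +
    96 * C_LV * C_y with hM
  have hC72' : 0 ≤ C_y ^ ((7 : ℝ) / 2) := by positivity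
  have hM0 : 6400000000 ≤ M := by rw [hM]; nlinarith [hC_LV.le, hC_y0'.le]
  refine ⟨A ^ ((6 : ℝ) / 5), max (max x₀LV x₀y) (max x₀1 (Real.exp M)), by positivity,
    fun x y hx hy8 hy6 hy200 hα h𝓟 ι T θ hsep a ha δ hδlo hδ1 hlarge => ?_⟩
  have hx₀LV : x₀LV ≤ x := le_trans ((le_max_left _ _).trans (le_max_left _ _)) hx
  have hx₀y : x₀y ≤ x := le_trans ((le_max_right _ _).trans (le_max_left _ _)) hx
  have hx₀1 : x₀1 ≤ x := le_trans ((le_max_left _ _).trans (le_max_right _ _)) hx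
  have hxe : Real.exp M ≤ x := le_trans ((le_max_right _ _).trans (le_max_right _ _)) hx
  ------------------------------------------------------------------
  -- ### the range
  set L₀ := Real.log x with hL₀
  have hLM : M ≤ L₀ := by
    have := Real.log_le_log (Real.exp_pos _) hxe; rwa [Real.log_exp] at this
  have hL64 : 6400000000 ≤ L₀ := le_trans hM0 hLM
  have hx1 : 1 < x := by
    have : (1 : ℝ) < Real.exp M := by have := Real.add_one_le_exp M; linarith
    exact lt_of_lt_of_le this hxe
  have hx0 : 0 < x := by linarith
  have hL2 : 2 ≤ L₀ := by linarith
  have hL1 : 1 ≤ L₀ := by linarith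
  have hL0 : 0 < L₀ := by linarith
  have hy4 : Real.log x ^ 4 ≤ y := le_trans (pow_le_pow_right₀ hL1 (by norm_num)) hy8
  have hy3 : Real.log x ^ 3 ≤ y := le_trans (pow_le_pow_right₀ hL1 (by norm_num)) hy8
  have hyL : L₀ ^ 2 ≤ y := le_trans (pow_le_pow_right₀ hL1 (by norm_num)) hy8
  have hy1 : (1 : ℝ) ≤ y := by nlinarith
  have hy0 : (0 : ℝ) < y := by linarith
  have hy2 : 2 ≤ y := by exact_mod_cast (show (2 : ℝ) ≤ y by nlinarith)
  have hy6' : Real.log y ≤ Real.log x ^ (1 / 6 : ℝ) := by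
    refine hy6.trans ?_
    have : 0 ≤ Real.log x ^ (1 / 6 : ℝ) := by positivity
    linarith
  have hlogy : Real.log y ≤ L₀ := by
    refine hy6'.trans ?_
    calc Real.log x ^ (1 / 6 : ℝ) ≤ Real.log x ^ (1 : ℝ) := Real.rpow_le_rpow_of_exponent_le hL1 (by norm_num)
      _ = L₀ := by rw [Real.rpow_one]
  have hyx : (y : ℝ) ≤ x := by
    rw [← Real.exp_log hy0, ← Real.exp_log hx0]; exact Real.exp_le_exp.mpr hlogy
  have hlogy1 : 1 ≤ Real.log y := by
    -- `y ≥ L₀² ≥ e`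
    have : Real.exp 1 ≤ y := by
      have h1 : Real.exp 1 ≤ 3 := by have := Real.exp_one_lt_d9; linarith
      nlinarith
    have := Real.log_le_log (Real.exp_pos 1) this
    rwa [Real.log_exp] at this
  set α := saddlePoint x y with hαdef
  have hα1 : α ≤ 1 := (hlt1 x y hx₀1 hy3 hyx hy6').le
  have hα0 : 0 < α := by linarith
  set ζt := smoothZeta α y / Real.sqrt (saddlePhi₂ α y) with hζt
  set 𝓟 := x ^ α * ζt with h𝓟def
  have h𝓟0 : 0 < 𝓟 := lt_of_lt_of_le (by positivity) h𝓟
  -- `y^{1-α} ≤ C_y L₀²`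
  have hyε : (y : ℝ) ^ (1 - α) ≤ C_y * L₀ ^ 2 := by
    have h1 := hyb x y hx₀y hy3 hyx
    rw [← hαdef] at h1
    refine h1.trans ?_
    have hu1 : Real.log x / Real.log y ≤ L₀ := by
      rw [div_le_iff₀ (by linarith)]; nlinarith
    have hu0 : 0 ≤ Real.log x / Real.log y := by positivity
    have hlog : Real.log (Real.log x / Real.log y + 1) ≤ L₀ := by
      calc Real.log (Real.log x / Real.log y + 1) ≤ Real.log x / Real.log y + 1 - 1 :=
            Real.log_le_sub_one_of_pos (by linarith)
        _ ≤ L₀ := by linarith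
    have hlog0 : 0 ≤ Real.log (Real.log x / Real.log y + 1) := Real.log_nonneg (by linarith)
    calc C_y0 * (Real.log x / Real.log y * Real.log (Real.log x / Real.log y + 1))
        ≤ C_y * (L₀ * L₀) := by
          apply mul_le_mul hC_yge (mul_le_mul hu1 hlog hlog0 hL0.le) (by positivity) hC_y0'.le
      _ = C_y * L₀ ^ 2 := by ring
  ------------------------------------------------------------------
  -- ### largeness facts
  have hfact1 : L₀ ^ (2 : ℕ) ≤ x ^ ((1 : ℝ) / 20000) :=
    logpow_le_rpow (n := 2) (by norm_num) hx1 (by norm_num; linarith)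
  have hfact2 : L₀ ^ (4 : ℕ) ≤ x ^ ((1 : ℝ) / 2) :=
    logpow_le_rpow (n := 4) (by norm_num) hx1 (by norm_num; linarith)
  have hC72 : 0 ≤ C_y ^ ((7 : ℝ) / 2) := by positivity
  have hbig1 : 48 * C_LV * C_y ^ ((7 : ℝ) / 2) ≤ L₀ ^ 5 := by
    have h1 : 48 * C_LV * C_y ^ ((7 : ℝ) / 2) ≤ L₀ := by rw [hM] at hLM; nlinarith [hC_LV.le, hC_y0'.le]
    calc 48 * C_LV * C_y ^ ((7 : ℝ) / 2) ≤ L₀ := h1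
      _ = L₀ ^ 1 := (pow_one _).symm
      _ ≤ L₀ ^ 5 := pow_le_pow_right₀ hL1 (by norm_num)
  have hbig2 : 24 * C_LV ≤ L₀ ^ 2 := by
    have h1 : 24 * C_LV ≤ L₀ := by rw [hM] at hLM; nlinarith [hC_LV.le, hC_y0'.le]
    nlinarith
  have hbig3 : 3936 * C_LV * C_y ≤ L₀ ^ 30 := by
    have h1 : 3936 * C_LV * C_y ≤ L₀ ^ 2 := by
      have : 96 * C_LV * C_y ≤ L₀ := by rw [hM] at hLM; nlinarith [hC_LV.le, hC_y0'.le]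
      nlinarith
    exact h1.trans (pow_le_pow_right₀ hL1 (by norm_num))
  have hbig4 : 4392 * C_LV * C_y ^ 2 ≤ L₀ ^ 28 := by
    have h1 : 4392 * C_LV * C_y ^ 2 ≤ L₀ := by rw [hM] at hLM; nlinarith [hC_LV.le, hC_y0'.le]
    calc 4392 * C_LV * C_y ^ 2 ≤ L₀ := h1
      _ = L₀ ^ 1 := (pow_one _).symm
      _ ≤ L₀ ^ 28 := pow_le_pow_right₀ hL1 (by norm_num)
  have hbig5 : 12 * C_LV ≤ x ^ ((99 : ℝ) / 10000) := by
    have h1 : 12 * C_LV ≤ (99 / 10000) * L₀ := by rw [hM] at hLM; nlinarith [hC_LV.le, hC_y0'.le]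
    have h2 : (99 / 10000) * L₀ + 1 ≤ x ^ ((99 : ℝ) / 10000) := by
      rw [Real.rpow_def_of_pos hx0, ← hL₀]
      have := Real.add_one_le_exp (99 / 10000 * L₀)
      rw [show Real.log x * (99 / 10000) = 99 / 10000 * L₀ by rw [hL₀]; ring]; linarith
    linarith
  have hbig6 : 96 * C_LV * C_y * L₀ ^ 3 ≤ x ^ ((19957 : ℝ) / 20000) := by
    have h1 : 96 * C_LV * C_y ≤ L₀ := by rw [hM] at hLM; nlinarith [hC_LV.le, hC_y0'.le]
    calc 96 * C_LV * C_y * L₀ ^ 3 ≤ L₀ * L₀ ^ 3 := mul_le_mul_of_nonneg_right h1 (by positivity)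
      _ = L₀ ^ (4 : ℕ) := by ring
      _ ≤ x ^ ((1 : ℝ) / 2) := hfact2
      _ ≤ x ^ ((19957 : ℝ) / 20000) := Real.rpow_le_rpow_of_exponent_le hx1.le (by norm_num)
  ------------------------------------------------------------------
  -- ### the parameters
  have hδ0 : 0 < δ := lt_of_lt_of_le (by positivity) hδlo
  set δ' : ℝ := min δ (1 / L₀) with hδ'
  have hδ'δ : δ' ≤ δ := min_le_left _ _
  have hδ'L : δ' ≤ 1 / L₀ := min_le_right _ _
  have hδ'0 : 0 < δ' := lt_min hδ0 (by positivity)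
  have hδ'lo : L₀ * x ^ (-((1 : ℝ) / 20000)) ≤ δ' := by
    refine le_min hδlo ?_
    -- `L₀ x^{-1/20000} ≤ 1/L₀` iff `L₀² ≤ x^{1/20000}`
    rw [Real.rpow_neg hx0.le, ← div_eq_mul_inv, div_le_div_iff₀ (by positivity) hL0, one_mul]
    calc L₀ * L₀ = L₀ ^ (2 : ℕ) := by ring
      _ ≤ x ^ ((1 : ℝ) / 20000) := hfact1
  have hδ'ge : δ / L₀ ≤ δ' := by
    refine le_min (div_le_self hδ0.le hL1) ?_
    exact div_le_div_of_nonneg_right hδ1 hL0.le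
  set u : ℝ := L₀ / δ' with hu
  have hu0 : 0 < u := by positivity
  have huL : L₀ ^ 2 ≤ u := by
    rw [hu, le_div_iff₀ hδ'0]
    calc L₀ ^ 2 * δ' ≤ L₀ ^ 2 * (1 / L₀) := mul_le_mul_of_nonneg_left hδ'L (by positivity)
      _ = L₀ := by field_simp
  have hu4 : 4 ≤ u := le_trans (by nlinarith) huL
  have hu2 : 2 ≤ u := by linarith
  have hu1 : 1 ≤ u := by linarith
  have hux : u ≤ x ^ ((1 : ℝ) / 20000) := by
    rw [hu, div_le_iff₀ hδ'0]
    have : L₀ = x ^ ((1 : ℝ) / 20000) * (L₀ * x ^ (-((1 : ℝ) / 20000))) := by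
      rw [Real.rpow_neg hx0.le]; field_simp
    rw [this]
    exact mul_le_mul_of_nonneg_left hδ'lo (by positivity)
  have huδ : u ≤ L₀ ^ 2 / δ := by
    rw [hu, div_le_div_iff₀ hδ'0 hδ0]
    calc L₀ * δ = L₀ ^ 2 * (δ / L₀) := by field_simp
      _ ≤ L₀ ^ 2 * δ' := mul_le_mul_of_nonneg_left hδ'ge (by positivity)
  have hδ'sq : L₀ ^ 2 * u ^ (-(2 : ℝ)) = δ' ^ 2 := by
    rw [hu, Real.rpow_neg (by positivity), show (2 : ℝ) = ((2 : ℕ) : ℝ) by norm_num, Real.rpow_natCast]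
    field_simp
  -- `K = ⌊u²⁰⌋`, `Q⋆ = K²`
  set K : ℕ := ⌊u ^ (20 : ℕ)⌋₊ with hKdef
  have hu20 : 2 ≤ u ^ (20 : ℕ) := by
    calc (2 : ℝ) = 2 ^ 1 := by norm_num
      _ ≤ u ^ 1 := by rw [pow_one, pow_one]; exact hu2
      _ ≤ u ^ (20 : ℕ) := pow_le_pow_right₀ hu1 (by norm_num)
  have hKu : (K : ℝ) ≤ u ^ (20 : ℕ) := Nat.floor_le (by positivity)
  have hKlo : u ^ (20 : ℕ) / 2 ≤ (K : ℝ) := half_le_floor hu20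
  have hK16r : (16 : ℝ) ≤ K := params_K_pos hu2 hKlo
  have hK16 : 16 ≤ K := by exact_mod_cast hK16r
  have hK0 : (0 : ℝ) < K := by linarith
  have hKx : (K : ℝ) ≤ x ^ ((1 : ℝ) / 1000) := by
    calc (K : ℝ) ≤ u ^ (20 : ℕ) := hKu
      _ ≤ (x ^ ((1 : ℝ) / 20000)) ^ (20 : ℕ) := pow_le_pow_left₀ hu0.le hux 20
      _ = x ^ ((1 : ℝ) / 1000) := by rw [← Real.rpow_natCast, ← Real.rpow_mul hx0.le]; norm_num
  have hK1000 : (K : ℝ) ^ 1000 ≤ x := by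
    calc (K : ℝ) ^ 1000 ≤ (x ^ ((1 : ℝ) / 1000)) ^ (1000 : ℕ) := pow_le_pow_left₀ hK0.le hKx 1000
      _ = x := by rw [← Real.rpow_natCast, ← Real.rpow_mul hx0.le]; norm_num
  set Qs : ℝ := (K : ℝ) ^ 2 with hQs
  have hQs1 : 1 ≤ Qs := by rw [hQs]; nlinarith
  have hyx200 : (y : ℝ) ≤ x ^ ((1 : ℝ) / 200) := by
    have h : (x ^ ((1 : ℝ) / 200)) ^ (200 : ℕ) = x := by
      rw [← Real.rpow_natCast, ← Real.rpow_mul hx0.le]; norm_num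
    exact le_of_pow_le_pow_left₀ (by norm_num) (by positivity) (hy200.trans_eq h.symm)
  have hx992 : (2 : ℝ) ≤ x ^ ((992 : ℝ) / 1000) := by
    have : Real.exp 1 ≤ x ^ ((992 : ℝ) / 1000) := by
      rw [Real.rpow_def_of_pos hx0, ← hL₀]
      exact Real.exp_le_exp.mpr (by nlinarith)
    have h2 : (2 : ℝ) ≤ Real.exp 1 := by have := Real.add_one_le_exp (1 : ℝ); linarith
    linarith
  have hQsW : 2 * Qs ≤ x / (y * K) := by
    rw [le_div_iff₀ (by positivity), hQs]
    -- `2 K³ y ≤ 2 x^{3/1000} x^{1/200} ≤ x`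
    calc 2 * (K : ℝ) ^ 2 * (y * K) = 2 * ((K : ℝ) ^ 3 * y) := by ring
      _ ≤ 2 * ((x ^ ((1 : ℝ) / 1000)) ^ (3 : ℕ) * x ^ ((1 : ℝ) / 200)) := by gcongr
      _ = 2 * x ^ ((8 : ℝ) / 1000) := by
          rw [← Real.rpow_natCast, ← Real.rpow_mul hx0.le, ← Real.rpow_add hx0]; norm_num
      _ ≤ x ^ ((992 : ℝ) / 1000) * x ^ ((8 : ℝ) / 1000) := mul_le_mul_of_nonneg_right hx992 (by positivity)
      _ = x := by rw [← Real.rpow_add hx0]; norm_num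
  have hQsx : Qs ^ 2 * (K : ℝ) ^ 2 * (y : ℝ) ^ 2 ≤ x := by
    rw [hQs]
    calc ((K : ℝ) ^ 2) ^ 2 * (K : ℝ) ^ 2 * (y : ℝ) ^ 2 = (K : ℝ) ^ 6 * (y : ℝ) ^ 2 := by ring
      _ ≤ (x ^ ((1 : ℝ) / 1000)) ^ (6 : ℕ) * (x ^ ((1 : ℝ) / 200)) ^ (2 : ℕ) := by gcongr
      _ = x ^ ((16 : ℝ) / 1000) := by
          rw [← Real.rpow_natCast, ← Real.rpow_natCast, ← Real.rpow_mul hx0.le, ← Real.rpow_mul hx0.le,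
            ← Real.rpow_add hx0]; norm_num
      _ ≤ x ^ (1 : ℝ) := Real.rpow_le_rpow_of_exponent_le hx1.le (by norm_num)
      _ = x := Real.rpow_one x
  ------------------------------------------------------------------
  -- ### the large-values inequality and the smallness
  have hineq := hLV x y hx₀LV hy8 hy6 hy200 K hK16 hK1000 Qs hQs1 hQsW hQsx T θ hsep a ha δ hδ0 hlarge
  rw [← hαdef] at hineq
  set N1 : ℝ := Real.log x ^ 4 * ((y : ℝ) * K) ^ (1 - α) * (y : ℝ) ^ (5 / 2 * (1 - α)) *
    ((K : ℝ) ^ (1 / 2 - α) + Real.sqrt K * Qs ^ (-(1 / 2 : ℝ) + 3 / 2 * (1 - α))) with hN1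
  set N2 : ℝ := (1 + Real.log y) ^ 2 * (1 + Real.log Qs) * Qs ^ (1 - α) * (K : ℝ) ^ (-α) *
    (y : ℝ) ^ (1 - α) with hN2
  set N3 : ℝ := Real.log y * (1 + Real.log Qs + Real.log K + Real.log (Qs ^ 2 * y * (K : ℝ) ^ 2 + 1)) *
    (y : ℝ) ^ (1 - α) * (Qs ^ 2 * y * (K : ℝ) ^ 2) ^ (1 - α) / K with hN3
  set Mw : ℝ := (1 + Real.log y) ^ 2 * (Qs * y * K) ^ (1 - α) with hMw
  set E : ℝ := (K : ℝ) ^ (-(α / 2)) + (N1 + N2 + N3) + x ^ ((19 : ℝ) / 20) / 𝓟 +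
    Mw * (1 + Real.log x) * Qs / x with hE
  set R : ℝ := (T.card : ℝ) with hR
  have hineq' : δ ^ 2 * R ^ 2 ≤ C_LV * (R ^ 2 * E + Mw * (1 + Real.log x) ^ ((23 : ℝ) / 2) * R ^ ((7 : ℝ) / 6)) :=
    hineq
  -- the six smallness bounds
  have s1 := small_KA (C := C_LV) hL2 huL hKlo hKu hα hC_LV.le hbig2
  have s2 := small_N1 (C := C_LV) (y := (y : ℝ)) (Qs := Qs) hL2 huL hKlo hKu hQs hα hα1 hy1 hyε hC_y1 hC_LV.le hbig1
  have s3 := small_N2 (C := C_LV) (y := (y : ℝ)) (Qs := Qs) hL2 huL hKlo hKu hQs hα hα1 hy1 hlogy hyε hC_y1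
    hC_LV.le hbig3
  have s4 := small_N3 (C := C_LV) (y := (y : ℝ)) (Qs := Qs) hL2 huL hKlo hKu hQs hα hα1 hy1 hlogy hyε hC_y1
    hC_LV.le hbig4
  have s5 := small_x1920 (C := C_LV) (L₀ := L₀) hx1 hL1 hu0 hux h𝓟 hC_LV.le hbig5
  have s6 := small_MQ (C := C_LV) (y := (y : ℝ)) (Qs := Qs) (L₀ := L₀) hx1 (by rw [hL₀]) hL2 huL hKlo hKu hQs
    hα hα1 hy1 hlogy hyε hC_y1 hC_LV.le hux hbig6
  have hsmall : C_LV * E ≤ δ ^ 2 / 2 := by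
    have hsum : C_LV * E ≤ 6 * (L₀ ^ 2 * u ^ (-(2 : ℝ)) / 12) := by
      rw [hE, hN1, hN2, hN3, hMw]
      have := add_le_add (add_le_add (add_le_add (add_le_add (add_le_add s1 s2) s3) s4) s5) s6
      refine le_trans (le_of_eq ?_) (this.trans (le_of_eq (by ring)))
      rw [hL₀]; ring
    rw [hδ'sq] at hsum
    have : δ' ^ 2 ≤ δ ^ 2 := pow_le_pow_left₀ hδ'0.le hδ'δ 2
    linarith
  ------------------------------------------------------------------
  -- ### solve for `R` and simplify
  have hMw0 : 0 ≤ Mw := by positivity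
  have hR0 : 0 ≤ R := by positivity
  have hLx1 : 0 ≤ 1 + Real.log x := by rw [← hL₀]; linarith
  have hRle := largeValues_bound_of_ineq hδ0 hR0 hC_LV.le hMw0 hLx1 hineq' hsmall
  refine hRle.trans ?_
  -- `Mw ≤ 4 C_y L₀⁴ u^{3/500}`, `u^{3/500} ≤ L₀^{6/500} δ^{-3/500}`, `(1+log x) ≤ 2 L₀`
  have hMwle : Mw ≤ 4 * C_y * L₀ ^ 4 * u ^ ((3 : ℝ) / 500) := by
    rw [hMw]
    have h1 : (1 + Real.log y) ^ 2 ≤ 4 * L₀ ^ 2 := by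
      have := Real.log_nonneg hy1; nlinarith
    have h2 : (Qs * y * K) ^ (1 - α) ≤ u ^ ((3 : ℝ) / 500) * (C_y * L₀ ^ 2) := by
      rw [show Qs * y * K = (K : ℝ) ^ 3 * y by rw [hQs]; ring, Real.mul_rpow (by positivity) hy0.le]
      refine mul_le_mul ?_ hyε (by positivity) (by positivity)
      rw [show ((K : ℝ) ^ 3 : ℝ) = (K : ℝ) ^ (3 : ℝ) by norm_cast, ← Real.rpow_mul hK0.le]
      exact params_K_rpow_small hu2 hKlo hKu (c := 3) (by norm_num) (by linarith)
    calc (1 + Real.log y) ^ 2 * (Qs * y * K) ^ (1 - α) ≤ (4 * L₀ ^ 2) * (u ^ ((3 : ℝ) / 500) * (C_y * L₀ ^ 2)) :=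
          mul_le_mul h1 h2 (by positivity) (by positivity)
      _ = 4 * C_y * L₀ ^ 4 * u ^ ((3 : ℝ) / 500) := by ring
  have hu3 : u ^ ((3 : ℝ) / 500) ≤ L₀ ^ ((6 : ℝ) / 500) * δ ^ (-((3 : ℝ) / 500)) := by
    calc u ^ ((3 : ℝ) / 500) ≤ (L₀ ^ 2 / δ) ^ ((3 : ℝ) / 500) := Real.rpow_le_rpow hu0.le huδ (by norm_num)
      _ = L₀ ^ ((6 : ℝ) / 500) * δ ^ (-((3 : ℝ) / 500)) := by
          rw [Real.div_rpow (by positivity) hδ0.le, Real.rpow_neg hδ0.le, div_eq_mul_inv]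
          congr 1
          rw [show (L₀ ^ 2 : ℝ) = L₀ ^ (2 : ℝ) by norm_cast, ← Real.rpow_mul hL0.le]; norm_num
  have hLx : (1 + Real.log x) ^ ((23 : ℝ) / 2) ≤ 2 ^ ((23 : ℝ) / 2) * L₀ ^ ((23 : ℝ) / 2) := by
    rw [← Real.mul_rpow (by norm_num) hL0.le]
    exact Real.rpow_le_rpow hLx1 (by rw [← hL₀]; linarith) (by norm_num)
  -- the base of the `6/5`-th power
  have hbase : 2 * C_LV * Mw * (1 + Real.log x) ^ ((23 : ℝ) / 2) / δ ^ 2 ≤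
      A * L₀ ^ ((7756 : ℝ) / 500) * δ ^ (-((1003 : ℝ) / 500)) := by
    rw [div_le_iff₀ (by positivity)]
    have h1 : 2 * C_LV * Mw * (1 + Real.log x) ^ ((23 : ℝ) / 2) ≤
        2 * C_LV * (4 * C_y * L₀ ^ 4 * (L₀ ^ ((6 : ℝ) / 500) * δ ^ (-((3 : ℝ) / 500)))) *
          (2 ^ ((23 : ℝ) / 2) * L₀ ^ ((23 : ℝ) / 2)) := by
      apply mul_le_mul _ hLx (by positivity) (by positivity)
      apply mul_le_mul_of_nonneg_left _ (by positivity)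
      exact hMwle.trans (mul_le_mul_of_nonneg_left hu3 (by positivity))
    refine h1.trans (le_of_eq ?_)
    -- bookkeeping of powers of `L₀` and `δ`
    have eL : L₀ ^ 4 * L₀ ^ ((6 : ℝ) / 500) * L₀ ^ ((23 : ℝ) / 2) = L₀ ^ ((7756 : ℝ) / 500) := by
      rw [show (L₀ ^ 4 : ℝ) = L₀ ^ (4 : ℝ) by norm_cast, ← Real.rpow_add hL0, ← Real.rpow_add hL0]; norm_num
    have eδ : δ ^ (-((3 : ℝ) / 500)) = δ ^ (-((1003 : ℝ) / 500)) * δ ^ 2 := by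
      rw [show (δ ^ 2 : ℝ) = δ ^ (2 : ℝ) by norm_cast, ← Real.rpow_add hδ0]; norm_num
    rw [eδ, hA]
    calc 2 * C_LV * (4 * C_y * L₀ ^ 4 * (L₀ ^ ((6 : ℝ) / 500) * (δ ^ (-((1003 : ℝ) / 500)) * δ ^ 2))) *
          (2 ^ ((23 : ℝ) / 2) * L₀ ^ ((23 : ℝ) / 2))
        = 8 * 2 ^ ((23 : ℝ) / 2) * C_LV * C_y * (L₀ ^ 4 * L₀ ^ ((6 : ℝ) / 500) * L₀ ^ ((23 : ℝ) / 2)) *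
            δ ^ (-((1003 : ℝ) / 500)) * δ ^ 2 := by ring
      _ = _ := by rw [eL]
  have hbase0 : 0 ≤ 2 * C_LV * Mw * (1 + Real.log x) ^ ((23 : ℝ) / 2) / δ ^ 2 := by positivity
  calc (2 * C_LV * Mw * (1 + Real.log x) ^ ((23 : ℝ) / 2) / δ ^ 2) ^ ((6 : ℝ) / 5)
      ≤ (A * L₀ ^ ((7756 : ℝ) / 500) * δ ^ (-((1003 : ℝ) / 500))) ^ ((6 : ℝ) / 5) :=
        Real.rpow_le_rpow hbase0 hbase (by norm_num)
    _ = A ^ ((6 : ℝ) / 5) * L₀ ^ ((7756 : ℝ) / 500 * (6 / 5)) * δ ^ (-((1003 : ℝ) / 500) * (6 / 5)) := by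
        rw [Real.mul_rpow (by positivity) (by positivity), Real.mul_rpow (by positivity) (by positivity),
          ← Real.rpow_mul hL0.le, ← Real.rpow_mul hδ0.le]
    _ ≤ A ^ ((6 : ℝ) / 5) * L₀ ^ ((19 : ℕ) : ℝ) * δ ^ (-((49 : ℝ) / 20)) := by
        apply mul_le_mul _ _ (by positivity) (by positivity)
        · apply mul_le_mul_of_nonneg_left _ (by positivity)
          exact Real.rpow_le_rpow_of_exponent_le hL1 (by norm_num)
        · exact Real.rpow_le_rpow_of_exponent_ge hδ0 hδ1 (by norm_num)
    _ = A ^ ((6 : ℝ) / 5) * Real.log x ^ (19 : ℕ) * δ ^ (-((49 : ℝ) / 20)) := by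
        rw [Real.rpow_natCast, hL₀]

end Literature.NumberTheory.Sieve

end
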